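import Mathlib
import HarnessLib
import Summits.Ventures.LatticeQCDFlow.Exactness.SphereLuscherTrivialization

/-!
# The order-`K + 1` rate of the truncated Lüscher map is attained: the transported tilted mean of the cross term itself moves at `s^{K+1}·Var_s(V_K)`, which vanishes only if `V_K = Σ⟨∂̃S, ∂̃S̃⁽ᴷ⁾⟩` is constant on `Ω`

HONEST FRAMING: exact (Metropolis-corrected) sampling algorithms for lattice gauge theory;
figures of merit are autocorrelation/cost numbers at stated couplings and volumes; no
continuum-physics claim.

Venture `LatticeQCDFlow` (cell pub-lqcd), topic `Exactness`; FANOUT row 7 (`s0-cpn-null`).  NEW WORK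
of the cell over the tree's `Exactness/SphereLuscherTrivialization.lean` (this leg: for the flow of
`Σ_{k≤K}t^kS̃⁽ᵏ⁾`, `(d/ds)⟨H∘Φ_{s→c}⟩_s = s^{K+1}·Cov_s(H∘Φ_{s→c}, V_K)`),
`Exactness/SphereTimeDependentFlow.lean` (Chapman–Kolmogorov `Φ_{c→s}∘Φ_{s→c} = id`),
`Exactness/SphereGradientFlow.lean` (GEN-13: the radial cut-off `χ`, `= 1` on `Ω̃`, `C¹`-ness of
`∂̃` off the poles) and `Exactness/SphereLuscherFiniteTimeUniqueness.lean` (GEN-12: `π̄` charges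
open sets); nothing is cited as a fact.  Printed counterpart, NAMED ONLY: M. Lüscher, Commun.
Math. Phys. 293 (2010) 899, §4.3 (what the truncation leaves behind).

The defect bounds of `Exactness/SphereLOMapSecondOrder.lean` / `SphereLuscherTruncationDefect.lean`
are UPPER bounds.  THIS FILE shows the rate law is ATTAINED by an explicit observable:

* §1 **the cut-off carré du champ** `z ↦ χ(z)·Σ_n⟪∂̃_nS(z), ∂̃_nF(z)⟫` is `C¹` on the ambient space
  (**`contDiff_sphereCutoff_mul_sum_inner_siteGrad`**) and equals `V = Σ⟨∂̃S, ∂̃F⟩` on `Ω`;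
* §2 **THE RATE IS ATTAINED** (**`hasDerivAt_tiltedMean_carre_comp_sphereTDFlow_partialSum`**): for
  the observable `H⋆ = (χ·V_K)∘Φ_{c→s₀}` (so that `H⋆∘Φ_{s₀→c} = V_K` on `Ω`),
  `(d/ds)|_{s₀}⟨H⋆∘Φ_{s→c}⟩_s = s₀^{K+1}·Var_{s₀}(V_K)`, `Var_s(V) = ⟨V²⟩_s − ⟨V⟩_s²`;
* §3 **THE OBSTRUCTION** (**`tiltedVar_pos_of_exists_ne`**): `Var_s(V) > 0` as soon as the continuous
  `V` takes two different values on `Ω` — so unless the cross term `V_K` is CONSTANT on `Ω` (in which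
  case `S̃⁽ᴷ⁺¹⁾` may be taken `0` and the truncation is exact to the next order), the order-`K` map is
  not trivializing beyond order `K + 1`: some `C¹` observable's transported tilted mean moves at the
  exact rate `s^{K+1}Var_s(V_K) ≠ 0` (`s ≠ 0`) (**`deriv_tiltedMean_ne_zero_of_carre_ne`**).

NOT CLAIMED: the size of `Var_s(V_K)` (its growth with the volume is the expected extensivity of a
sum of local terms, not typed); anything about the rung's numbers.
-/

noncomputable section

namespace Summit.Ventures.LatticeQCDFlow.Exactness

open Function Set Metric MeasureTheory NormedSpace InnerProductSpace
open scoped RealInnerProductSpace Topology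

variable {Λ : Type*} {E : Type*} [NormedAddCommGroup E] [InnerProductSpace ℝ E]
  [FiniteDimensional ℝ E] [Fintype Λ] [DecidableEq Λ]

/-! ## §1 The cut-off carré du champ is a `C¹` ambient observable -/

section Carre

/-- **`z ↦ χ(z)·Σ_n⟪∂̃_nS(z), ∂̃_nF(z)⟫` is `C¹` on the ambient space** (`S, F ∈ C²`): off the poles a
product of smooth and `C¹` maps, near a pole identically zero. -/
theorem contDiff_sphereCutoff_mul_sum_inner_siteGrad {S F : (Λ → E) → ℝ} (hS : ContDiff ℝ 2 S)
    (hF : ContDiff ℝ 2 F) :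
    ContDiff ℝ 1 fun z : Λ → E => sphereCutoff z * ∑ n, ⟪siteGrad n S z, siteGrad n F z⟫ := by
  refine contDiff_iff_contDiffAt.2 fun x₀ => ?_
  by_cases h : ∀ m, x₀ m ≠ 0
  · exact (contDiff_sphereCutoff 1).contDiffAt.mul
      (ContDiffAt.sum fun n _ => (contDiffAt_siteGrad hS n (h n)).inner ℝ (contDiffAt_siteGrad hF n (h n)))
  · simp only [ne_eq, not_forall, not_not] at h
    obtain ⟨m, hm⟩ := h
    have hm' : ‖x₀ m‖ ^ 2 < 1 / 4 := by rw [hm, norm_zero]; norm_num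
    have hev : (fun z : Λ → E => sphereCutoff z * ∑ n, ⟪siteGrad n S z, siteGrad n F z⟫) =ᶠ[𝓝 x₀]
        fun _ => 0 := by
      filter_upwards [sphereCutoff_eventuallyEq_zero hm'] with x hx
      simp only [hx, zero_mul]
    exact (contDiffAt_const (c := (0 : ℝ))).congr_of_eventuallyEq hev

omit [DecidableEq Λ] [InnerProductSpace ℝ E] [FiniteDimensional ℝ E] in
/-- On `Ω` the cut-off is `1`. -/
theorem sphereCutoff_sphereConfig (ω : Λ → sphere (0 : E) 1) :
    sphereCutoff (fun m => (ω m : E)) = 1 :=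
  sphereCutoff_eq_one fun n => norm_eq_of_mem_sphere (ω n)

end Carre

/-! ## §2 The rate is attained -/

section Attained

variable [MeasurableSpace E] [BorelSpace E] [Nontrivial E]
variable {S : (Λ → E) → ℝ} {St : ℕ → (Λ → E) → ℝ} {c : ℕ → ℝ}

/-- **THE ORDER-`K + 1` RATE IS ATTAINED.**  For a `C²` action `S`, a `C²` Lüscher series
`(S̃⁽ᵏ⁾, ċ_k)` of `S`, the flow `Φ = sphereTDFlow _ T` of `Σ_{k≤K}t^kS̃⁽ᵏ⁾`, `|s₀| ≤ |T| + 1`, and the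
`C¹` observable `H⋆ = (χ·V_K)∘Φ_{cf→s₀}` (`V_K = Σ_n⟨∂̃_nS, ∂̃_nS̃⁽ᴷ⁾⟩`; `H⋆∘Φ_{s₀→cf} = V_K` on `Ω`):
`(d/ds)|_{s₀}⟨H⋆∘Φ_{s→cf}⟩_s = s₀^{K+1}·(⟨V_K·V_K⟩_{s₀} − ⟨V_K⟩_{s₀}·⟨V_K⟩_{s₀})`. -/
theorem hasDerivAt_tiltedMean_carre_comp_sphereTDFlow_partialSum (hS : ContDiff ℝ 2 S)
    (hSt : ∀ k, ContDiff ℝ 2 (St k))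
    (h0 : ∀ ξ : Λ → sphere (0 : E) 1,
      -∑ n, siteLaplacian n (St 0) (fun m => (ξ m : E)) = S (fun m => (ξ m : E)) + c 0)
    (hs : ∀ k, ∀ ξ : Λ → sphere (0 : E) 1,
      -∑ n, siteLaplacian n (St (k + 1)) (fun m => (ξ m : E)) =
        -(∑ n, ⟪siteGrad n S (fun m => (ξ m : E)), siteGrad n (St k) (fun m => (ξ m : E))⟫) +
          c (k + 1))
    (K : ℕ) (T cf : ℝ) {s₀ : ℝ} (hs₀ : |s₀| ≤ |T| + 1) :
    HasDerivAt (fun s =>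
        (∫ ω, Real.exp (-(s * S (fun m => ((ω : Λ → sphere (0 : E) 1) m : E)))) *
            (fun z : Λ → E => sphereCutoff (sphereTDFlow (G := fun t z => ∑ k ∈ Finset.range (K + 1),
                t ^ k * St k z) (contDiff_partialSum_joint hSt K) T cf s₀ z) *
              ∑ n, ⟪siteGrad n S (sphereTDFlow (G := fun t z => ∑ k ∈ Finset.range (K + 1),
                  t ^ k * St k z) (contDiff_partialSum_joint hSt K) T cf s₀ z),
                siteGrad n (St K) (sphereTDFlow (G := fun t z => ∑ k ∈ Finset.range (K + 1),
                  t ^ k * St k z) (contDiff_partialSum_joint hSt K) T cf s₀ z)⟫)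
              (sphereTDFlow (G := fun t z => ∑ k ∈ Finset.range (K + 1), t ^ k * St k z)
                (contDiff_partialSum_joint hSt K) T s cf (fun m => (ω m : E)))
          ∂Measure.pi (fun _ : Λ => uniformSphere (volume : Measure E))) /
          ∫ ω, Real.exp (-(s * S (fun m => ((ω : Λ → sphere (0 : E) 1) m : E))))
            ∂Measure.pi (fun _ : Λ => uniformSphere (volume : Measure E)))
      (s₀ ^ (K + 1) *
        ((∫ ω, Real.exp (-(s₀ * S (fun m => ((ω : Λ → sphere (0 : E) 1) m : E)))) *
              (∑ n, ⟪siteGrad n S (fun m => (ω m : E)), siteGrad n (St K) (fun m => (ω m : E))⟫) *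
                ∑ n, ⟪siteGrad n S (fun m => (ω m : E)), siteGrad n (St K) (fun m => (ω m : E))⟫
            ∂Measure.pi (fun _ : Λ => uniformSphere (volume : Measure E))) /
            (∫ ω, Real.exp (-(s₀ * S (fun m => ((ω : Λ → sphere (0 : E) 1) m : E))))
              ∂Measure.pi (fun _ : Λ => uniformSphere (volume : Measure E))) -
          (∫ ω, Real.exp (-(s₀ * S (fun m => ((ω : Λ → sphere (0 : E) 1) m : E)))) *
              ∑ n, ⟪siteGrad n S (fun m => (ω m : E)), siteGrad n (St K) (fun m => (ω m : E))⟫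
            ∂Measure.pi (fun _ : Λ => uniformSphere (volume : Measure E))) /
            (∫ ω, Real.exp (-(s₀ * S (fun m => ((ω : Λ → sphere (0 : E) 1) m : E))))
              ∂Measure.pi (fun _ : Λ => uniformSphere (volume : Measure E))) *
          ((∫ ω, Real.exp (-(s₀ * S (fun m => ((ω : Λ → sphere (0 : E) 1) m : E)))) *
                ∑ n, ⟪siteGrad n S (fun m => (ω m : E)), siteGrad n (St K) (fun m => (ω m : E))⟫
              ∂Measure.pi (fun _ : Λ => uniformSphere (volume : Measure E))) /
            ∫ ω, Real.exp (-(s₀ * S (fun m => ((ω : Λ → sphere (0 : E) 1) m : E))))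
              ∂Measure.pi (fun _ : Λ => uniformSphere (volume : Measure E))))) s₀ := by
  have hG := contDiff_partialSum_joint (Λ := Λ) hSt K
  have hH : ContDiff ℝ 1 fun z : Λ → E => sphereCutoff (sphereTDFlow (G := fun t z =>
      ∑ k ∈ Finset.range (K + 1), t ^ k * St k z) hG T cf s₀ z) *
        ∑ n, ⟪siteGrad n S (sphereTDFlow (G := fun t z => ∑ k ∈ Finset.range (K + 1),
          t ^ k * St k z) hG T cf s₀ z),
          siteGrad n (St K) (sphereTDFlow (G := fun t z => ∑ k ∈ Finset.range (K + 1),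
            t ^ k * St k z) hG T cf s₀ z)⟫ :=
    (contDiff_sphereCutoff_mul_sum_inner_siteGrad hS (hSt K)).comp (contDiff_sphereTDFlow_apply hG cf s₀)
  have h := hasDerivAt_tiltedMean_comp_sphereTDFlow_partialSum (hS.of_le (by norm_num)) hSt h0 hs K
    hH T cf hs₀
  refine h.congr_deriv ?_
  simp only [sphereTDFlow_symm, sphereCutoff_sphereConfig, one_mul]

end Attained

/-! ## §3 The obstruction: a non-constant cross term has positive tilted variance -/

section Obstruction

variable [MeasurableSpace E] [BorelSpace E] [Nontrivial E]

omit [DecidableEq Λ] in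
/-- **`Var_s(V) > 0` for a continuous `V` taking two different values on `Ω`**:
`⟨V·V⟩_s − ⟨V⟩_s·⟨V⟩_s > 0` (`= ⟨(V − ⟨V⟩_s)²⟩_s`, and `π̄` charges every open set). -/
theorem tiltedVar_pos_of_exists_ne {S : (Λ → E) → ℝ} (hS : Continuous S) (s : ℝ)
    {V : (Λ → sphere (0 : E) 1) → ℝ} (hV : Continuous V) {ω₁ ω₂ : Λ → sphere (0 : E) 1}
    (hne : V ω₁ ≠ V ω₂) :
    0 < (∫ ω, Real.exp (-(s * S (fun m => ((ω : Λ → sphere (0 : E) 1) m : E)))) * V ω * V ω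
          ∂Measure.pi (fun _ : Λ => uniformSphere (volume : Measure E))) /
          (∫ ω, Real.exp (-(s * S (fun m => ((ω : Λ → sphere (0 : E) 1) m : E))))
            ∂Measure.pi (fun _ : Λ => uniformSphere (volume : Measure E))) -
        (∫ ω, Real.exp (-(s * S (fun m => ((ω : Λ → sphere (0 : E) 1) m : E)))) * V ω
            ∂Measure.pi (fun _ : Λ => uniformSphere (volume : Measure E))) /
            (∫ ω, Real.exp (-(s * S (fun m => ((ω : Λ → sphere (0 : E) 1) m : E))))
              ∂Measure.pi (fun _ : Λ => uniformSphere (volume : Measure E))) *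
          ((∫ ω, Real.exp (-(s * S (fun m => ((ω : Λ → sphere (0 : E) 1) m : E)))) * V ω
              ∂Measure.pi (fun _ : Λ => uniformSphere (volume : Measure E))) /
            ∫ ω, Real.exp (-(s * S (fun m => ((ω : Λ → sphere (0 : E) 1) m : E))))
              ∂Measure.pi (fun _ : Λ => uniformSphere (volume : Measure E))) := by
  set μ : Measure (Λ → sphere (0 : E) 1) := Measure.pi (fun _ : Λ => uniformSphere (volume : Measure E))
    with hμ
  set w : (Λ → sphere (0 : E) 1) → ℝ := fun ω => Real.exp (-(s * S (fun m => (ω m : E)))) with hw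
  set Z : ℝ := ∫ ω, w ω ∂μ with hZdef
  set Vbar : ℝ := (∫ ω, w ω * V ω ∂μ) / Z with hVbar
  have hwc : Continuous w := continuous_exp_neg_mul_sphereConfig hS s
  have hwpos : ∀ ω, 0 < w ω := fun ω => Real.exp_pos _
  have hZ : 0 < Z := integral_exp_neg_mul_pos (Λ := Λ) (E := E) hS s
  have hiw : Integrable w μ := integrable_pi_of_continuous _ hwc
  have hiV : Integrable (fun ω => w ω * V ω) μ := integrable_pi_of_continuous _ (hwc.mul hV)
  have hiVV : Integrable (fun ω => w ω * V ω * V ω) μ :=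
    integrable_pi_of_continuous _ ((hwc.mul hV).mul hV)
  -- the variance as the mean square deviation
  have hdev : Integrable (fun ω => w ω * (V ω - Vbar) ^ 2) μ :=
    integrable_pi_of_continuous _ (hwc.mul ((hV.sub continuous_const).pow 2))
  have e : ∫ ω, w ω * (V ω - Vbar) ^ 2 ∂μ =
      (∫ ω, w ω * V ω * V ω ∂μ) - 2 * Vbar * (∫ ω, w ω * V ω ∂μ) + Vbar ^ 2 * Z := by
    have hsplit : ∀ ω, w ω * (V ω - Vbar) ^ 2 =
        w ω * V ω * V ω - 2 * Vbar * (w ω * V ω) + Vbar ^ 2 * w ω := fun ω => by ring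
    simp_rw [hsplit]
    have hi0 : Integrable (fun ω => 2 * Vbar * (w ω * V ω)) μ := hiV.const_mul _
    have hi1 : Integrable (fun ω => w ω * V ω * V ω - 2 * Vbar * (w ω * V ω)) μ := hiVV.sub hi0
    have hi2 : Integrable (fun ω => Vbar ^ 2 * w ω) μ := hiw.const_mul _
    rw [integral_add hi1 hi2, integral_sub hiVV hi0, integral_const_mul, integral_const_mul]
  have key : (∫ ω, w ω * V ω * V ω ∂μ) / Z - (∫ ω, w ω * V ω ∂μ) / Z * ((∫ ω, w ω * V ω ∂μ) / Z) =
      (∫ ω, w ω * (V ω - Vbar) ^ 2 ∂μ) / Z := by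
    rw [e, hVbar]
    field_simp
    ring
  rw [key]
  refine div_pos ?_ hZ
  -- strict positivity: the integrand is continuous, nonnegative and not identically zero
  have hnn : ∀ ω, 0 ≤ w ω * (V ω - Vbar) ^ 2 := fun ω => mul_nonneg (hwpos ω).le (sq_nonneg _)
  rcases (integral_nonneg (μ := μ) (f := fun ω => w ω * (V ω - Vbar) ^ 2) hnn).lt_or_eq with hpos | hzero
  · exact hpos
  · exfalso
    have hae := (integral_eq_zero_iff_of_nonneg hnn hdev).1 hzero.symm
    haveI : (uniformSphere (volume : Measure E)).IsOpenPosMeasure := by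
      rw [uniformSphere]
      exact Measure.isOpenPosMeasure_smul _ (ENNReal.inv_ne_zero.2 (measure_ne_top _ _))
    haveI := Measure.pi.isOpenPosMeasure (fun _ : Λ => uniformSphere (volume : Measure E))
    have hfun := (Continuous.ae_eq_iff_eq μ (hwc.mul ((hV.sub continuous_const).pow 2))
      (continuous_const : Continuous fun _ : Λ → sphere (0 : E) 1 => (0 : ℝ))).1 hae
    have hpt : ∀ ξ : Λ → sphere (0 : E) 1, V ξ = Vbar := fun ξ => by
      have h1 : w ξ * (V ξ - Vbar) ^ 2 = 0 := congrFun hfun ξ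
      rcases mul_eq_zero.1 h1 with h | h
      · exact absurd h (hwpos ξ).ne'
      · exact sub_eq_zero.1 ((pow_eq_zero_iff two_ne_zero).1 h)
    have hV1 : V ω₁ = Vbar := hpt ω₁
    have hV2 : V ω₂ = Vbar := hpt ω₂
    exact hne (hV1.trans hV2.symm)

variable {S : (Λ → E) → ℝ} {St : ℕ → (Λ → E) → ℝ} {c : ℕ → ℝ}

/-- **THE ORDER-`K` MAP IS NOT TRIVIALIZING BEYOND ORDER `K + 1` UNLESS THE CROSS TERM IS CONSTANT.**
Under the hypotheses of `hasDerivAt_tiltedMean_carre_comp_sphereTDFlow_partialSum`, if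
`V_K = Σ⟨∂̃S, ∂̃S̃⁽ᴷ⁾⟩` takes two different values on `Ω` and `s₀ ≠ 0`, the transported tilted mean
of the observable `H⋆` has NONZERO derivative `s₀^{K+1}·Var_{s₀}(V_K)` at `s₀`. -/
theorem deriv_tiltedMean_ne_zero_of_carre_ne (hS : ContDiff ℝ 2 S) (hSt : ∀ k, ContDiff ℝ 2 (St k))
    (h0 : ∀ ξ : Λ → sphere (0 : E) 1,
      -∑ n, siteLaplacian n (St 0) (fun m => (ξ m : E)) = S (fun m => (ξ m : E)) + c 0)
    (hs : ∀ k, ∀ ξ : Λ → sphere (0 : E) 1,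
      -∑ n, siteLaplacian n (St (k + 1)) (fun m => (ξ m : E)) =
        -(∑ n, ⟪siteGrad n S (fun m => (ξ m : E)), siteGrad n (St k) (fun m => (ξ m : E))⟫) +
          c (k + 1))
    (K : ℕ) (T cf : ℝ) {s₀ : ℝ} (hs₀ : |s₀| ≤ |T| + 1) (hs₀0 : s₀ ≠ 0)
    {ω₁ ω₂ : Λ → sphere (0 : E) 1}
    (hne : ∑ n, ⟪siteGrad n S (fun m => (ω₁ m : E)), siteGrad n (St K) (fun m => (ω₁ m : E))⟫ ≠
      ∑ n, ⟪siteGrad n S (fun m => (ω₂ m : E)), siteGrad n (St K) (fun m => (ω₂ m : E))⟫) :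
    deriv (fun s =>
        (∫ ω, Real.exp (-(s * S (fun m => ((ω : Λ → sphere (0 : E) 1) m : E)))) *
            (fun z : Λ → E => sphereCutoff (sphereTDFlow (G := fun t z => ∑ k ∈ Finset.range (K + 1),
                t ^ k * St k z) (contDiff_partialSum_joint hSt K) T cf s₀ z) *
              ∑ n, ⟪siteGrad n S (sphereTDFlow (G := fun t z => ∑ k ∈ Finset.range (K + 1),
                  t ^ k * St k z) (contDiff_partialSum_joint hSt K) T cf s₀ z),
                siteGrad n (St K) (sphereTDFlow (G := fun t z => ∑ k ∈ Finset.range (K + 1),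
                  t ^ k * St k z) (contDiff_partialSum_joint hSt K) T cf s₀ z)⟫)
              (sphereTDFlow (G := fun t z => ∑ k ∈ Finset.range (K + 1), t ^ k * St k z)
                (contDiff_partialSum_joint hSt K) T s cf (fun m => (ω m : E)))
          ∂Measure.pi (fun _ : Λ => uniformSphere (volume : Measure E))) /
          ∫ ω, Real.exp (-(s * S (fun m => ((ω : Λ → sphere (0 : E) 1) m : E))))
            ∂Measure.pi (fun _ : Λ => uniformSphere (volume : Measure E))) s₀ ≠ 0 := by
  rw [(hasDerivAt_tiltedMean_carre_comp_sphereTDFlow_partialSum hS hSt h0 hs K T cf hs₀).deriv]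
  refine mul_ne_zero (pow_ne_zero _ hs₀0) (ne_of_gt ?_)
  exact tiltedVar_pos_of_exists_ne hS.continuous s₀
    (continuous_finsetSum _ fun n _ =>
      continuous_inner_siteGrad ((hSt K).of_le (by norm_num)) (hS.of_le (by norm_num)) n n) hne

end Obstruction

end Summit.Ventures.LatticeQCDFlow.Exactness

end
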